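import Literature.MathematicalPhysics.QuantumManyBody.LiebSimpleEquation
import Mathlib.Analysis.LConvolution
import HarnessLib

/-!
# Lieb's simple equation (Carlen–Jauslin–Lieb): the resolvent `K_e` by monotone iteration — definitions

Topic: `Literature/MathematicalPhysics/QuantumManyBody`. Definitions only (real bodies, no
theory), for the proof of CJL-I Theorem 1 (`CarlenJauslinLieb2020_thm1`; CJL-I =
Carlen–Jauslin–Lieb, Pure Appl. Anal. 2 (2020), arXiv:1912.04987, §1 (1.12)–(1.16) and §2).

CJL write the simple equation as `u = K_e 𝒱 + 2eρ K_e u∗u` with the resolvent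
`K_e = (−Δ + 4e + 𝒱)⁻¹` ((1.13), Kato–Rellich on `W^{2,p}`), use that `K_e` has a positive
kernel (Trotter) with `0 ≤ K_e(x,y) ≤ G_e(x,y)` ((1.15), from the resolvent identity (1.14)
`K_e = G_e − G_e𝒱K_e`), and solve by monotone iteration (§2). In the tree everything is in the
mild (Yukawa) form of `LiebSimpleEquation.lean` (`G_c f = Y_c ∗ f`), and the positive operator
`K = (−Δ + c + U)⁻¹` is CONSTRUCTED, for `[0,∞]`-valued data and Mathlib's lower-integral
convolution `⋆ₗ`, as follows.

* `kMap c M U φ w = G_{c+M}(φ + (M − U) w)` — for a bounded potential `0 ≤ U ≤ M` the equation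
  `(−Δ + c + U) w = φ`, i.e. `(−Δ + c + M) w = φ + (M − U) w`, is the fixed-point problem of this
  MONOTONE map (the Neumann-series form of Kato–Rellich; all terms are non-negative).
* `kSup c M U φ w₀ = ⨆ₙ kMapⁿ w₀` — the supremum of the iteration from `w₀` (from `w₀ = 0`: the
  minimal solution, which is `K φ`; its fixed-point property, the bound `K φ ≤ G_c φ`, the
  equation `Kφ + G_c(U·Kφ) = G_c φ` and uniqueness of bounded solutions are theorems of the
  companion file `LiebSimpleEquationResolvent.lean`).
* `kRes c V φ = ⨅_M kSup c (M+1) (V ⊓ (M+1)) φ 0` — for an UNBOUNDED potential `V ≥ 0` (CJL's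
  `𝒱 ∈ L¹ ∩ Lᵖ`): the solutions for the truncated potentials `min(V, M+1)` decrease with `M`, and
  their infimum solves `w + G_c(V w) = G_c φ` (companion file). This is the tree's `K φ` for
  `K = (−Δ + c + V)⁻¹` on non-negative data.

Junk values: none of the three needs hypotheses to make sense (`⋆ₗ`, `⨆`, `⨅` are total); the
theory assumes `0 < c`, `0 < M`, `U ≤ M`, measurability, and `G_c φ` bounded.

## References

* [CarlenJauslinLieb2020] E. A. Carlen, I. Jauslin, E. H. Lieb, *Analysis of a simple equation for
  the ground state energy of the Bose gas*, Pure Appl. Anal. 2 (2020) 659–684, arXiv:1912.04987: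
  (1.12)–(1.16) (the operator `K_e`, resolvent identity, `0 ≤ K_e ≤ G_e`), §2 (2.1)–(2.2)
  (solution by monotone iteration).
-/

noncomputable section

open MeasureTheory
open scoped ENNReal

namespace Literature.MathematicalPhysics.QuantumManyBody

namespace LiebSimpleEquation

open BoseGas (Space)

/-- **The weighted resolvent map** `T w = G_{c+M}(φ + (M − U) w) = Y_{c+M} ⋆ₗ (φ + (M − U) w)`,
whose fixed points are the mild solutions of `(−Δ + c + U) w = φ` when `0 ≤ U ≤ M` (the
positivity-preserving Neumann-series form of `K = (−Δ + c + U)⁻¹`, CJL-I (1.13)–(1.15)); `M − U`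
is truncated subtraction in `[0, ∞]`. [cite: CarlenJauslinLieb2020, (1.13)–(1.16)] -/
def kMap (c M : ℝ) (U φ w : Space → ℝ≥0∞) : Space → ℝ≥0∞ :=
  (ENNReal.ofReal ∘ yukawa (c + M)) ⋆ₗ fun y => φ y + (ENNReal.ofReal M - U y) * w y

/-- **The supremum of the monotone iteration** `w₀ ≤ T w₀ ≤ T² w₀ ≤ …` of `kMap` (CJL-I §2:
"adapted to solution by iteration, because of its monotonicity properties"); from `w₀ = 0` this is
the minimal solution `K φ`. [cite: CarlenJauslinLieb2020, (2.1)–(2.2)] -/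
def kSup (c M : ℝ) (U φ w₀ : Space → ℝ≥0∞) (x : Space) : ℝ≥0∞ :=
  ⨆ n : ℕ, ((kMap c M U φ)^[n] w₀) x

/-- **The resolvent `K = (−Δ + c + V)⁻¹` on non-negative data for an unbounded potential
`V ≥ 0`**: the infimum over the truncation levels `M + 1` (`M ∈ ℕ`) of the minimal solutions for
the bounded potentials `min(V, M + 1)` (these decrease with `M`). For CJL's `𝒱 ∈ L¹ ∩ Lᵖ`,
`c = 4e`: `kRes (4e) (ofReal ∘ 𝒱) φ = K_e φ`. [cite: CarlenJauslinLieb2020, (1.13)–(1.16)] -/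
def kRes (c : ℝ) (V φ : Space → ℝ≥0∞) (x : Space) : ℝ≥0∞ :=
  ⨅ M : ℕ, kSup c ((M : ℝ) + 1) (fun y => min (V y) (ENNReal.ofReal ((M : ℝ) + 1))) φ 0 x

/-- Unfolding `kMap`. [cite: CarlenJauslinLieb2020, (1.13)–(1.16)] -/
theorem kMap_apply (c M : ℝ) (U φ w : Space → ℝ≥0∞) (x : Space) :
    kMap c M U φ w x = ((ENNReal.ofReal ∘ yukawa (c + M)) ⋆ₗ
      fun y => φ y + (ENNReal.ofReal M - U y) * w y) x := rfl

/-- Unfolding `kSup`. [cite: CarlenJauslinLieb2020, (2.1)–(2.2)] -/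
theorem kSup_apply (c M : ℝ) (U φ w₀ : Space → ℝ≥0∞) (x : Space) :
    kSup c M U φ w₀ x = ⨆ n : ℕ, ((kMap c M U φ)^[n] w₀) x := rfl

/-- Unfolding `kRes`. [cite: CarlenJauslinLieb2020, (1.13)–(1.16)] -/
theorem kRes_apply (c : ℝ) (V φ : Space → ℝ≥0∞) (x : Space) :
    kRes c V φ x = ⨅ M : ℕ,
      kSup c ((M : ℝ) + 1) (fun y => min (V y) (ENNReal.ofReal ((M : ℝ) + 1))) φ 0 x := rfl

/-- Each iterate lies below `kSup`. [folklore] -/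
theorem iterate_kMap_le_kSup (c M : ℝ) (U φ w₀ : Space → ℝ≥0∞) (n : ℕ) :
    (kMap c M U φ)^[n] w₀ ≤ kSup c M U φ w₀ :=
  fun x => le_iSup (fun n : ℕ => ((kMap c M U φ)^[n] w₀) x) n

/-- `kRes` lies below each truncated minimal solution. [folklore] -/
theorem kRes_le_kSup (c : ℝ) (V φ : Space → ℝ≥0∞) (M : ℕ) :
    kRes c V φ ≤ kSup c ((M : ℝ) + 1) (fun y => min (V y) (ENNReal.ofReal ((M : ℝ) + 1))) φ 0 :=
  fun x => iInf_le (fun M : ℕ =>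
    kSup c ((M : ℝ) + 1) (fun y => min (V y) (ENNReal.ofReal ((M : ℝ) + 1))) φ 0 x) M

end LiebSimpleEquation

end Literature.MathematicalPhysics.QuantumManyBody
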